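import Literature.Topology.FourManifolds.SimplyConnectedSecondHomology
import Literature.AlgebraicTopology.SingularHomology.CapProduct
import Literature.AlgebraicTopology.SingularHomology.IntersectionForm
import HarnessLib

/-!
# The Kronecker pairing on cohomology modulo torsion, `Hᵏ(X; ℤ)/T × Hₖ(X; ℤ) → ℤ`

Topic `Literature/Topology/FourManifolds`; in the cone of the named fact
`Literature.Topology.FourManifolds.isHCobordant_of_equivalent_intersectionForm` (**Wall 1964,
Thm. 2**; C. T. C. Wall, *On simply-connected 4-manifolds*, J. London Math. Soc. 39 (1964)
141–149; `HCobordismDonaldson.lean`), companion of `LatticeDualityAnnihilator.lean` (the pure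
algebra of the homology/cohomology dictionary of Wall's proof) — this file supplies the PAIRING
that algebra is applied to.

The tree's intersection lattice is `Hᵏ(X; ℤ)/T` (`freeCohomology`, `IntersectionForm.lean`), its
Kronecker pairing `⟨-, -⟩ : Hᵏ(X; ℤ) × Hₖ(X; ℤ) → ℤ` lives on `Hᵏ(X; ℤ)` (`kroneckerPairing`,
`CapProduct.lean`; Hatcher 2002, §3.1 p. 191 and §3.3 p. 241). Since `ℤ` is torsion-free,
torsion classes pair to zero, so the pairing descends:

* `freeKroneckerPairing X k : Hᵏ(X; ℤ)/T →ₗ Dual ℤ Hₖ(X; ℤ)` — **the Kronecker pairing modulo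
  torsion** (`Submodule.liftQ`; `freeKroneckerPairing_mk : ⟨[a], c⟩ = ⟨a, c⟩`).
* `freeKroneckerPairing_map` — **naturality** `⟨f^* b, c⟩ = ⟨b, f_* c⟩` (Hatcher 2002, p. 201),
  from `kroneckerPairing_map`; this is the adjointness hypothesis of every entry of
  `LatticeDualityAnnihilator.lean`.
* `freeKroneckerPairing_surjective` — onto `Hom(Hₖ, ℤ)` always (universal coefficients over a
  PID, the tree's `kroneckerPairing_surjective`, Hatcher Thm. 3.2).
* `freeKroneckerPairing_bijective_of_isZero` — bijective when `Hₖ₋₁(X; ℤ) = 0` (vanishing `Ext`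
  term, `kroneckerPairing_bijective_of_isZero`); in particular in degree `2` for simply connected
  `X` (`freeKroneckerPairing_two_bijective`).
* `isPerfPair_freeKroneckerPairing_two` — **for a closed simply connected topological 4-manifold
  `M : Type` the pairing `H²(M; ℤ)/T × H₂(M; ℤ) → ℤ` is perfect** (both adjoints bijective): the
  left adjoint by the previous item, the right one by reflexivity of the finitely generated free
  `H₂(M; ℤ)` (`free_singularHomology_two_of_simplyConnectedSpace`, Kirby 1989 Ch. II §1, from
  Poincaré duality; `finite_singularHomology_of_compactSpace_holds`), Mathlib's
  `LinearMap.IsPerfPair.of_bijective`.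

Everything is proved; the only definition is `freeKroneckerPairing`; no named fact is introduced.

## References

* A. Hatcher, *Algebraic Topology*, CUP (2002), §3.1 pp. 191–201 (Thm. 3.2, Cor. 3.3,
  naturality), §3.3 p. 241. [HatcherAT2002]
* R. C. Kirby, *The topology of 4-manifolds*, LNM 1374 (1989), Ch. II §1. [Kirby1989]
* C. T. C. Wall, *On simply-connected 4-manifolds*, J. London Math. Soc. 39 (1964), §2.
  [WallJLMS1964]
-/

open Function Module CategoryTheory CategoryTheory.Limits
open Literature.AlgebraicTopology.SingularHomology

noncomputable section

universe u

namespace Literature.Topology.FourManifolds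

/-! ### The pairing -/

section Pairing

variable (X : Type u) [TopologicalSpace X] (k : ℕ)

/-- **Torsion classes pair to zero**: the torsion of `Hᵏ(X; ℤ)` lies in the kernel of the
Kronecker map `Hᵏ(X; ℤ) → Hom(Hₖ(X; ℤ), ℤ)` (its target is torsion-free). [cite: HatcherAT2002, §3.1 Cor. 3.3 (p. 196)] -/
theorem torsion_le_ker_kroneckerPairing :
    Submodule.torsion ℤ ↥(singularCohomology ℤ ℤ X k) ≤ LinearMap.ker (kroneckerPairing ℤ ℤ X k) := by
  intro a ha
  have h := freeCohomology.torsion_le_comap_torsion (kroneckerPairing ℤ ℤ X k) ha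
  rw [Submodule.mem_comap, Submodule.isTorsionFree_iff_torsion_eq_bot.mp inferInstance,
    Submodule.mem_bot] at h
  exact h

/-- **The Kronecker pairing modulo torsion**, `Hᵏ(X; ℤ)/T → Hom(Hₖ(X; ℤ), ℤ)`, `[a] ↦ ⟨a, -⟩`
(Hatcher 2002, §3.1 p. 191 "evaluation of cochains on chains", §3.3 p. 241; descends to the
quotient by `torsion_le_ker_kroneckerPairing`). [cite: HatcherAT2002, §3.1 p. 191 and §3.3 p. 241] -/
def freeKroneckerPairing : ↥(freeCohomology ℤ X k) →ₗ[ℤ] Dual ℤ ↥(singularHomology ℤ ℤ X k) :=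
  (Submodule.torsion ℤ ↥(singularCohomology ℤ ℤ X k)).liftQ (kroneckerPairing ℤ ℤ X k)
    (torsion_le_ker_kroneckerPairing X k)

variable {X k}

/-- `⟨[a], c⟩ = ⟨a, c⟩`: the pairing modulo torsion on the class of a cohomology class is the
Kronecker pairing. [cite: HatcherAT2002, §3.1 p. 191] -/
@[simp] theorem freeKroneckerPairing_mk (a : singularCohomology ℤ ℤ X k) :
    freeKroneckerPairing X k (freeCohomology.mk a) = kroneckerPairing ℤ ℤ X k a :=
  rfl

/-- **The Kronecker map modulo torsion is onto `Hom(Hₖ, ℤ)`** (universal coefficients over a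
PID, Hatcher 2002 Thm. 3.2: already `Hᵏ → Hom(Hₖ, ℤ)` is onto, `kroneckerPairing_surjective`).
[cite: HatcherAT2002, §3.1 Thm. 3.2 (p. 195)] -/
theorem freeKroneckerPairing_surjective : Surjective (freeKroneckerPairing X k) := fun φ => by
  obtain ⟨a, ha⟩ := kroneckerPairing_surjective ℤ X k φ
  exact ⟨freeCohomology.mk a, ha⟩

/-- **Naturality** `⟨f^* b, c⟩ = ⟨b, f_* c⟩` of the pairing modulo torsion, for `f : X → Y`,
`b ∈ Hᵏ(Y; ℤ)/T`, `c ∈ Hₖ(X; ℤ)` (Hatcher 2002, §3.1 p. 201; from `kroneckerPairing_map`). This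
is the adjointness of `f^*` and `f_*` consumed by `LatticeDualityAnnihilator.lean`.
[cite: HatcherAT2002, §3.1 p. 201] -/
theorem freeKroneckerPairing_map {Y : Type u} [TopologicalSpace Y] (f : C(X, Y))
    (b : freeCohomology ℤ Y k) (c : singularHomology ℤ ℤ X k) :
    freeKroneckerPairing X k (freeCohomology.map f k b) c =
      freeKroneckerPairing Y k b (singularHomology.map ℤ ℤ f k c) := by
  induction b using freeCohomology.induction_on with
  | h a => rw [freeCohomology.map_mk, freeKroneckerPairing_mk, freeKroneckerPairing_mk,
      kroneckerPairing_map]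

/-- **The Kronecker map modulo torsion is bijective when `Hₖ(X; ℤ) = 0`**, in degree `k + 1`
(Hatcher 2002, Thm. 3.2 with vanishing `Ext` term: `Hᵏ⁺¹ → Hom(Hₖ₊₁, ℤ)` is then bijective,
`kroneckerPairing_bijective_of_isZero`, so the torsion of `Hᵏ⁺¹` is zero and the quotient map is
an isomorphism). [cite: HatcherAT2002, §3.1 Thm. 3.2 (p. 195) and Cor. 3.3] -/
theorem freeKroneckerPairing_bijective_of_isZero {j : ℕ} (h : IsZero (singularHomology ℤ ℤ X j)) :
    Bijective (freeKroneckerPairing X (j + 1)) := by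
  refine ⟨fun x y hxy => ?_, freeKroneckerPairing_surjective⟩
  induction x using freeCohomology.induction_on with
  | h a =>
    induction y using freeCohomology.induction_on with
    | h b =>
      rw [freeKroneckerPairing_mk, freeKroneckerPairing_mk] at hxy
      rw [(kroneckerPairing_bijective_of_isZero ℤ X j h).1 hxy]

/-- **`H²(X; ℤ)/T ≅ Hom(H₂(X; ℤ), ℤ)` for `X` simply connected**: the pairing modulo torsion is
bijective in degree `2` (`H₁(X; ℤ) = 0`, Hatcher Thm. 2A.1 and Thm. 3.2).
[cite: HatcherAT2002, §3.1 Thm. 3.2 (p. 195) and Thm. 2A.1] -/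
theorem freeKroneckerPairing_two_bijective [SimplyConnectedSpace X] :
    Bijective (freeKroneckerPairing X 2) :=
  freeKroneckerPairing_bijective_of_isZero
    (isZero_singularHomology_one_of_simplyConnectedSpace ℤ ℤ (X := X))

end Pairing

/-! ### Perfectness for closed simply connected 4-manifolds -/

section Perfect

variable (M : Type) [TopologicalSpace M] [T2Space M] [ChartedSpace (EuclideanSpace ℝ (Fin 4)) M]
  [CompactSpace M] [SimplyConnectedSpace M]

/-- **The Kronecker pairing `H²(M; ℤ)/T × H₂(M; ℤ) → ℤ` of a closed simply connected topological
4-manifold `M : Type` is perfect** (both `H²/T → Hom(H₂, ℤ)` and `H₂ → Hom(H²/T, ℤ)` bijective):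
the first by `freeKroneckerPairing_two_bijective`, the second by reflexivity of `H₂(M; ℤ)`, a
finitely generated free abelian group (Kirby 1989, Ch. II §1: "`H₂(M; Z)` and `H²(M; Z)` are free
`Z`-modules of rank equal to the second Betti number"; tree theorems
`free_singularHomology_two_of_simplyConnectedSpace`, `finite_singularHomology_of_compactSpace_holds`;
Mathlib `LinearMap.IsPerfPair.of_bijective`). [cite: Kirby1989, Ch. II §1] [cite: HatcherAT2002, §3.1 Thm. 3.2 and §3.3 Thm. 3.30] -/
theorem isPerfPair_freeKroneckerPairing_two : (freeKroneckerPairing M 2).IsPerfPair := by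
  haveI : Module.Free ℤ (singularHomology ℤ ℤ M 2) :=
    free_singularHomology_two_of_simplyConnectedSpace M
  haveI : Module.Finite ℤ (singularHomology ℤ ℤ M 2) :=
    finite_singularHomology_of_compactSpace_holds ℤ M 4 2
  exact LinearMap.IsPerfPair.of_bijective _ freeKroneckerPairing_two_bijective

end Perfect

end Literature.Topology.FourManifolds

end
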